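import Literature.MathematicalPhysics.QuantumLattice.HubbardModel
import Literature.MathematicalPhysics.QuantumLattice.HubbardModelProofs
import HarnessLib

/-!
# Particle–hole symmetry of the Hubbard Hamiltonian: discharges

Family `hubbard` (trunk T-QLATTICE). Sibling proof file of
`Literature/MathematicalPhysics/QuantumLattice/HubbardModel.lean` (and of the prelude file
`FermionOperators` it builds on): it PROVES, from Mathlib, the accepted definitions, the CAR
discharges of `FermionOperatorsProofs.lean` and the bipartiteness of the even torus
(`torusStagger_eq_neg_of_adj_holds`, `HubbardModelProofs.lean`) only, the named facts
(`def X : Prop`, D-0014) listed below, as `theorem X_holds : X`, and the particle–hole relation between the sector ground-state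
energies of the Hubbard model on a bipartite graph, which is node F5a
(`Literature.MathematicalPhysics.QuantumLattice.hubbardChain_groundEnergyAt_particleHole`) of the Bethe-ansatz decomposition of
`Literature.MathematicalPhysics.QuantumLattice.lieb_wu` (`LiebWuBetheAnsatz.lean`). No definition and no statement is introduced or
changed here.

## Discharged named facts

* `Literature.MathematicalPhysics.QuantumLattice.particleHole_mem_unitaryGroup_holds`,
  `Literature.MathematicalPhysics.QuantumLattice.particleHole_mul_annihilation_mul_conjTranspose_holds` (`P c_i Pᴴ = ε_i c†_i`),
  `Literature.MathematicalPhysics.QuantumLattice.particleHole_mul_numberAt_mul_conjTranspose_holds` (`P n_i Pᴴ = 1 - n_i`) — the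
  particle–hole transformation of `FermionOperators`, for unimodular phases `ε`.
* `Literature.MathematicalPhysics.QuantumLattice.hamiltonian_particleHole_bipartite_holds` (`HubbardModel`): for a bipartite sign
  `ε : Λ → ℤˣ` on `G`, `P H(t, U) Pᴴ = H(t, U) - U N + U |Λ|`.

## Proved consequences

* `Literature.MathematicalPhysics.QuantumLattice.groundEnergyAt_particleHole`: on a graph with a bipartite sign, for all `t`, `U`
  and `N ≤ 2|Λ|`, `E(N) = E(2|Λ| - N) - (|Λ| - N) U` for the sector ground-state energies
  `groundEnergyAt G t U N` (Wave0's variational `groundEnergy`: the infimum of `re ⟨ψ, H ψ⟩` over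
  unit `N`-particle vectors). This is Lieb–Wu's `E(M, M') = -(N_a - N) U + E(N_a - M, N_a - M')`
  (Physica A 321 (2003) 1, §1, eq. (3)) summed over the spin label, and Essler et al. (2005)
  eq. (6.34) at half filling.
* `Literature.MathematicalPhysics.QuantumLattice.groundEnergyAt_fermionTorus_particleHole` (even torus, any `d`) and
  `Literature.MathematicalPhysics.QuantumLattice.groundEnergyAt_hubbardRing_particleHole`: on the ring of `2n` sites,
  `E(N) = E(4n - N) - (2n - N) U` for `N ≤ 4n` — verbatim the statement of F5a
  (`hubbardChain L = fermionTorusGraph 1 L`).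

## Proof sketches

* All operator identities are proved through the action on Fock vectors
  (`annihilation_mulVec_apply`: `(c_i ψ)(s) = [i ∉ s] jw(i, s) ψ(s ∪ {i})`;
  `creation_mulVec_apply`: `(c†_i ψ)(s) = [i ∈ s] jw(i, s ∖ i) ψ(s ∖ i)`;
  `particleHole_mulVec_apply`: `(P ψ)(t) = w(tᶜ) ψ(tᶜ)` with
  `w(s) = ∏_{i ∈ s} conj(ε_i) jw(i, univ)`), matrices being equal iff they act equally
  (`Matrix.mulVec_injective`); the Jordan–Wigner sign lemmas (`jwSign_mul_self`,
  `jwSign_insert_of_lt`, …) and the mixed CAR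
  `annihilation_mul_creation_add_creation_mul_annihilation_holds` are those of
  `FermionOperatorsProofs`. The particle–hole sign comes from `jw(a, univ) jw(a, tᶜ) = jw(a, t)`
  (the exponents over `t` and `tᶜ` add up) and `w conj(w) = 1`.
* `hamiltonian_particleHole_bipartite_holds`: `P c†_{xσ} c_{yσ} Pᴴ = ε_x ε_y c_{xσ} c†_{yσ}
  = -c_{xσ} c†_{yσ} = c†_{yσ} c_{xσ}` on an edge (mixed CAR for distinct orbitals), and the
  hopping sum over ordered adjacent pairs is symmetric under `x ↔ y`;
  `P n_{x↑} n_{x↓} Pᴴ = (1 - n_{x↑})(1 - n_{x↓})`, summed: `Σ n↑n↓ - N + |Λ|`.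
* `groundEnergyAt_particleHole`: `ψ ↦ Pᴴ ψ` maps unit `N`-particle vectors to unit
  `(2|Λ| - N)`-particle vectors with `⟨Pᴴψ, H Pᴴψ⟩ = ⟨ψ, P H Pᴴ ψ⟩ = ⟨ψ, H ψ⟩ - U N + U|Λ|`, and
  back; so the two variational sets are translates and so are their infima
  (`OrderIso.map_csInf'`; non-emptiness from a basis vector, boundedness below from the crude bound
  `re ⟨ψ, A ψ⟩ ≥ -Σ ‖A_{st}‖`, `neg_sum_norm_le_re_expect`).

## Sources

E. H. Lieb, *Two theorems on the Hubbard model*, PRL 62 (1989) 1201 (particle–hole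
transformation on bipartite lattices); H. Tasaki, *Physics and Mathematics of Quantum Many-Body
Systems* (2020) §§9.2–9.3 (Jordan–Wigner fermions, `η`-pairing and particle–hole maps);
O. Bratteli, D. W. Robinson, *Operator Algebras and Quantum Statistical Mechanics II* §5.2.2
(CAR); E. H. Lieb, F. Y. Wu, Physica A 321 (2003) 1 = arXiv:cond-mat/0207529, §1 eq. (3);
F. H. L. Essler et al., *The One-Dimensional Hubbard Model* (CUP 2005), eq. (6.34). All results
here are elementary finite-dimensional algebra ([folklore] tags on the individual lemmas).
-/

noncomputable section

open Matrix Finset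
open scoped ComplexOrder BigOperators

/-! ### Jordan–Wigner signs and the action of `c_i`, `c†_i` on Fock vectors -/

namespace Literature.MathematicalPhysics.QuantumLattice

section Fock

variable {ι : Type*} [LinearOrder ι]

/-- `‖jwSign i s‖ = 1`. [folklore] -/
@[simp] theorem norm_jwSign (i : ι) (s : Finset ι) : ‖jwSign i s‖ = 1 := by
  simp [jwSign]

/-- The Jordan–Wigner sign at `i` does not see `i` itself. [folklore] -/
theorem jwSign_erase_self (i : ι) (s : Finset ι) : jwSign i (s.erase i) = jwSign i s := by
  rw [jwSign, jwSign, Finset.filter_erase, Finset.erase_eq_of_notMem]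
  simp

/-- The Jordan–Wigner sign at `i` does not see `i` itself. [folklore] -/
theorem jwSign_insert_self (i : ι) (s : Finset ι) : jwSign i (insert i s) = jwSign i s :=
  jwSign_insert_of_not_lt (lt_irrefl i)

variable [Fintype ι]

/-- The action of `c_i`: `(c_i ψ)(s) = jwSign i s · ψ(insert i s)` for `i ∉ s`, else `0`.
Bratteli–Robinson II §5.2.2. [folklore] -/
theorem annihilation_mulVec_apply (i : ι) (ψ : Fock ι) (s : Finset ι) :
    (annihilation i *ᵥ ψ) s = if i ∉ s then jwSign i s * ψ (insert i s) else 0 := by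
  have h : ∀ t, annihilation i s t * ψ t =
      if insert i s = t then (if i ∉ s then jwSign i s * ψ (insert i s) else 0) else 0 := by
    intro t
    unfold annihilation
    by_cases hi : i ∈ s
    · simp [hi]
    · by_cases ht : insert i s = t
      · subst ht; simp [hi]
      · rw [if_neg ht, if_neg (fun h => ht h.2.symm), zero_mul]
  simp only [mulVec, dotProduct, h, Finset.sum_ite_eq, Finset.mem_univ, if_true]

/-- The action of `c†_i`: `(c†_i ψ)(s) = jwSign i (s ∖ i) · ψ(s ∖ i)` for `i ∈ s`, else `0`.
Bratteli–Robinson II §5.2.2. [folklore] -/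
theorem creation_mulVec_apply (i : ι) (ψ : Fock ι) (s : Finset ι) :
    (creation i *ᵥ ψ) s = if i ∈ s then jwSign i (s.erase i) * ψ (s.erase i) else 0 := by
  have h : ∀ t, creation i s t * ψ t =
      if s.erase i = t then (if i ∈ s then jwSign i (s.erase i) * ψ (s.erase i) else 0) else 0 := by
    intro t
    rw [creation_apply]
    by_cases hi : i ∈ s
    · by_cases ht : s.erase i = t
      · subst ht
        simp [hi, Finset.insert_erase hi]
      · have h' : ¬ (i ∉ t ∧ s = insert i t) := by
          rintro ⟨hit, rfl⟩
          exact ht (Finset.erase_insert hit)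
        simp [h', ht]
    · have h' : ¬ (i ∉ t ∧ s = insert i t) := by
        rintro ⟨-, rfl⟩
        exact hi (Finset.mem_insert_self i t)
      simp [h', hi]
  simp only [mulVec, dotProduct, h, Finset.sum_ite_eq, Finset.mem_univ, if_true]

omit [LinearOrder ι] in
/-- Two operators on the Fock space agree iff they act identically on every vector. [folklore] -/
theorem matrix_eq_of_mulVec_eq {A B : Matrix (Finset ι) (Finset ι) ℂ}
    (h : ∀ ψ : Fock ι, A *ᵥ ψ = B *ᵥ ψ) : A = B :=
  Matrix.mulVec_injective (funext h)

end Fock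

end Literature.MathematicalPhysics.QuantumLattice

/-! ### The particle–hole transformation -/

namespace Literature.MathematicalPhysics.QuantumLattice


section Fock

variable {ι : Type*} [LinearOrder ι] [Fintype ι]

/-- The sum of the Jordan–Wigner exponents over `t` and `tᶜ`: `jwSign a univ · jwSign a tᶜ = jwSign a t`.
[folklore] -/
theorem jwSign_univ_mul_jwSign_compl (a : ι) (t : Finset ι) :
    jwSign a univ * jwSign a tᶜ = jwSign a t := by
  have h : (univ.filter (· < a)).card = (t.filter (· < a)).card + (tᶜ.filter (· < a)).card := by
    rw [← Finset.card_union_of_disjoint (Finset.disjoint_filter_filter disjoint_compl_right),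
      ← Finset.filter_union, Finset.union_compl]
  rw [jwSign, jwSign, jwSign, h, pow_add, mul_assoc, ← pow_add, ← two_mul, pow_mul]
  norm_num

/-- Matrix entries of the particle–hole transformation (definitional unfolding). [folklore] -/
theorem particleHole_apply (ε : ι → ℂ) (t s : Finset ι) :
    particleHole ε t s = if t = sᶜ then ∏ i ∈ s, star (ε i) * jwSign i univ else 0 := rfl

/-- The action of the particle–hole transformation: `(P ψ)(t) = w(tᶜ) ψ(tᶜ)` with the weight
`w(s) = ∏_{i ∈ s} conj(ε i) · jwSign i univ`. Tasaki (2020) §9.3.3. [folklore] -/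
theorem particleHole_mulVec_apply (ε : ι → ℂ) (ψ : Fock ι) (t : Finset ι) :
    (particleHole ε *ᵥ ψ) t = (∏ i ∈ tᶜ, star (ε i) * jwSign i univ) * ψ tᶜ := by
  have h : ∀ s, particleHole ε t s * ψ s =
      if tᶜ = s then (∏ i ∈ tᶜ, star (ε i) * jwSign i univ) * ψ tᶜ else 0 := by
    intro s
    rw [particleHole_apply]
    by_cases hs : tᶜ = s
    · subst hs
      simp
    · rw [if_neg (fun h => hs (by rw [h, compl_compl])), if_neg hs, zero_mul]
  simp only [mulVec, dotProduct, h, Finset.sum_ite_eq, Finset.mem_univ, if_true]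

/-- The action of the adjoint particle–hole transformation: `(Pᴴ ψ)(t) = conj(w(t)) ψ(tᶜ)`.
Tasaki (2020) §9.3.3. [folklore] -/
theorem particleHole_conjTranspose_mulVec_apply (ε : ι → ℂ) (ψ : Fock ι) (t : Finset ι) :
    ((particleHole ε)ᴴ *ᵥ ψ) t = star (∏ i ∈ t, star (ε i) * jwSign i univ) * ψ tᶜ := by
  have h : ∀ s, (particleHole ε)ᴴ t s * ψ s =
      if tᶜ = s then star (∏ i ∈ t, star (ε i) * jwSign i univ) * ψ tᶜ else 0 := by
    intro s
    rw [conjTranspose_apply, particleHole_apply]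
    by_cases hs : tᶜ = s
    · subst hs
      simp
    · rw [if_neg (fun h => hs h.symm), if_neg hs, star_zero, zero_mul]
  simp only [mulVec, dotProduct, h, Finset.sum_ite_eq, Finset.mem_univ, if_true]

/-- For unimodular phases the particle–hole weight is unimodular: `w(s) conj(w(s)) = 1`.
[folklore] -/
theorem particleHoleWeight_mul_star (ε : ι → ℂ) (hε : ∀ i, ‖ε i‖ = 1) (s : Finset ι) :
    (∏ i ∈ s, star (ε i) * jwSign i univ) * star (∏ i ∈ s, star (ε i) * jwSign i univ) = 1 := by
  rw [star_prod, ← Finset.prod_mul_distrib]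
  refine Finset.prod_eq_one fun i _ => ?_
  have h1 : ε i * star (ε i) = 1 := by
    rw [Complex.star_def, Complex.mul_conj, Complex.normSq_eq_norm_sq, hε i]
    simp
  rw [star_mul', star_star, star_jwSign]
  calc star (ε i) * jwSign i univ * (ε i * jwSign i univ)
      = (ε i * star (ε i)) * (jwSign i univ * jwSign i univ) := by ring
    _ = 1 := by rw [h1, jwSign_mul_self, one_mul]

/-- `conj(w(s)) w(s) = 1`. [folklore] -/
theorem star_particleHoleWeight_mul (ε : ι → ℂ) (hε : ∀ i, ‖ε i‖ = 1) (s : Finset ι) :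
    star (∏ i ∈ s, star (ε i) * jwSign i univ) * (∏ i ∈ s, star (ε i) * jwSign i univ) = 1 := by
  rw [mul_comm, particleHoleWeight_mul_star ε hε]

/-- `P Pᴴ = 1` for unimodular phases. Tasaki (2020) §9.3.3. [folklore] -/
theorem particleHole_mul_conjTranspose (ε : ι → ℂ) (hε : ∀ i, ‖ε i‖ = 1) :
    particleHole ε * (particleHole ε)ᴴ = 1 := by
  apply matrix_eq_of_mulVec_eq
  intro ψ
  funext t
  rw [← mulVec_mulVec, particleHole_mulVec_apply, particleHole_conjTranspose_mulVec_apply,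
    compl_compl, one_mulVec, ← mul_assoc, particleHoleWeight_mul_star ε hε, one_mul]

/-- `Pᴴ P = 1` for unimodular phases. Tasaki (2020) §9.3.3. [folklore] -/
theorem particleHole_conjTranspose_mul (ε : ι → ℂ) (hε : ∀ i, ‖ε i‖ = 1) :
    (particleHole ε)ᴴ * particleHole ε = 1 := by
  apply matrix_eq_of_mulVec_eq
  intro ψ
  funext t
  rw [← mulVec_mulVec, particleHole_conjTranspose_mulVec_apply, particleHole_mulVec_apply,
    compl_compl, one_mulVec, ← mul_assoc, star_particleHoleWeight_mul ε hε, one_mul]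

/-- **Discharge of `particleHole_mem_unitaryGroup`.** For unimodular phases the particle–hole
transformation is unitary. Tasaki (2020) §9.3.3. [folklore] -/
theorem particleHole_mem_unitaryGroup_holds : particleHole_mem_unitaryGroup (ι := ι) := by
  intro ε hε
  rw [Matrix.mem_unitaryGroup_iff, star_eq_conjTranspose]
  exact particleHole_mul_conjTranspose ε hε

/-- **Discharge of `particleHole_mul_annihilation_mul_conjTranspose`.** `P c_i Pᴴ = ε_i c†_i`.
Tasaki (2020) §9.3.3. [folklore] -/
theorem particleHole_mul_annihilation_mul_conjTranspose_holds :
    particleHole_mul_annihilation_mul_conjTranspose (ι := ι) := by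
  intro ε hε a
  apply matrix_eq_of_mulVec_eq
  intro ψ
  funext t
  rw [← mulVec_mulVec, ← mulVec_mulVec, particleHole_mulVec_apply, annihilation_mulVec_apply,
    smul_mulVec, Pi.smul_apply, creation_mulVec_apply, smul_eq_mul]
  by_cases ha : a ∈ t
  · have hac : a ∉ tᶜ := fun h => (Finset.mem_compl.1 h) ha
    rw [if_pos hac, if_pos ha, particleHole_conjTranspose_mulVec_apply, Finset.compl_insert,
      compl_compl, Finset.prod_insert hac, star_mul', star_mul', star_star, star_jwSign,
      jwSign_erase_self, ← jwSign_univ_mul_jwSign_compl a t]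
    set w := ∏ i ∈ tᶜ, star (ε i) * jwSign i univ with hw
    calc w * (jwSign a tᶜ * (ε a * jwSign a univ * star w * ψ (t.erase a)))
        = (w * star w) * (ε a * (jwSign a univ * jwSign a tᶜ * ψ (t.erase a))) := by ring
      _ = ε a * (jwSign a univ * jwSign a tᶜ * ψ (t.erase a)) := by
          rw [hw, particleHoleWeight_mul_star ε hε, one_mul]
  · have hac : ¬ a ∉ tᶜ := not_not_intro (Finset.mem_compl.2 ha)
    rw [if_neg hac, if_neg ha, mul_zero, mul_zero]

/-- `P c†_i Pᴴ = conj(ε_i) c_i` (adjoint of the previous identity). Tasaki (2020) §9.3.3.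
[folklore] -/
theorem particleHole_mul_creation_mul_conjTranspose (ε : ι → ℂ) (hε : ∀ i, ‖ε i‖ = 1) (a : ι) :
    particleHole ε * creation a * (particleHole ε)ᴴ = star (ε a) • annihilation a := by
  have h := congrArg conjTranspose (particleHole_mul_annihilation_mul_conjTranspose_holds ε hε a)
  rwa [conjTranspose_mul, conjTranspose_mul, conjTranspose_conjTranspose, annihilation_conjTranspose,
    ← mul_assoc, conjTranspose_smul, creation_conjTranspose] at h

/-- **Discharge of `particleHole_mul_numberAt_mul_conjTranspose`.** `P n_i Pᴴ = 1 - n_i`.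
Tasaki (2020) §9.3.3. [folklore] -/
theorem particleHole_mul_numberAt_mul_conjTranspose_holds :
    particleHole_mul_numberAt_mul_conjTranspose (ι := ι) := by
  intro ε hε a
  apply matrix_eq_of_mulVec_eq
  intro ψ
  funext t
  rw [← mulVec_mulVec, ← mulVec_mulVec, particleHole_mulVec_apply, numberAt_eq_diagonal,
    mulVec_diagonal, particleHole_conjTranspose_mulVec_apply, compl_compl, sub_mulVec,
    Pi.sub_apply, one_mulVec, mulVec_diagonal]
  by_cases ha : a ∈ t
  · have hac : a ∉ tᶜ := fun h => (Finset.mem_compl.1 h) ha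
    rw [if_neg hac, if_pos ha, zero_mul, mul_zero, one_mul, sub_self]
  · rw [if_pos (Finset.mem_compl.2 ha), if_neg ha, one_mul, zero_mul, sub_zero, ← mul_assoc,
      particleHoleWeight_mul_star ε hε, one_mul]

end Fock

/-! ### Particle–hole conjugation of the Hubbard Hamiltonian on a bipartite graph -/

section General

variable {Λ : Type*} [LinearOrder Λ] [Fintype Λ] (G : SimpleGraph Λ) [DecidableRel G.Adj]

/-- The phases `ε' (x, σ) = ε x ∈ {±1} ⊆ ℂ` of a sign function `ε : Λ → ℤˣ` are unimodular.
[folklore] -/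
theorem norm_intCast_units (u : ℤˣ) : ‖((u : ℤ) : ℂ)‖ = 1 := by
  rcases Int.units_eq_one_or u with h | h <;> simp [h]

/-- The phases `ε' (x, σ) = ε x ∈ {±1} ⊆ ℂ` are real. [folklore] -/
theorem star_intCast_units (u : ℤˣ) : star (((u : ℤ) : ℂ)) = ((u : ℤ) : ℂ) := by
  rcases Int.units_eq_one_or u with h | h <;> simp [h]

/-- On an edge of a bipartite sign, `ε x ε y = -1` (in `ℂ`). [folklore] -/
theorem intCast_units_mul_of_eq_neg {u v : ℤˣ} (h : u = -v) :
    (((u : ℤ) : ℂ)) * ((v : ℤ) : ℂ) = -1 := by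
  subst h
  rcases Int.units_eq_one_or v with h | h <;> simp [h]

/-- **Discharge of `hamiltonian_particleHole_bipartite`.** For a bipartite sign `ε` on `G`
(`ε x = -ε y` on edges) and `P = particleHole (ε ∘ site)`, `P H(t, U) Pᴴ = H(t, U) - U N + U |Λ|`:
the hopping term is invariant (`P c†_{xσ} c_{yσ} Pᴴ = ε_x ε_y c_{xσ} c†_{yσ} = c†_{yσ} c_{xσ}` by the
CAR, and the sum over ordered adjacent pairs is symmetric) and
`P n_{x↑} n_{x↓} Pᴴ = (1 - n_{x↑})(1 - n_{x↓})`. Lieb, PRL 62 (1989) 1201; Tasaki (2020) §9.3.3;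
Lieb–Wu, Physica A 321 (2003) 1, §1 eq. (3). [folklore] -/
theorem hamiltonian_particleHole_bipartite_holds : hamiltonian_particleHole_bipartite G := by
  intro t U ε hε
  set ε' : Orb Λ → ℂ := fun i => ((ε (ofLex i).1 : ℤ) : ℂ) with hε'
  have hn : ∀ i, ‖ε' i‖ = 1 := fun i => norm_intCast_units _
  set P := particleHole ε' with hP
  have hPP : Pᴴ * P = 1 := particleHole_conjTranspose_mul ε' hn
  have hsplit : ∀ A B : Matrix (Finset (Orb Λ)) (Finset (Orb Λ)) ℂ,
      P * (A * B) * Pᴴ = (P * A * Pᴴ) * (P * B * Pᴴ) := by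
    intro A B
    simp only [Matrix.mul_assoc]
    rw [← Matrix.mul_assoc Pᴴ P, hPP, Matrix.one_mul]
  -- hopping terms
  have hhop : ∀ (x y : Λ) (σ : Fin 2), G.Adj x y →
      P * (creation (orb x σ) * annihilation (orb y σ)) * Pᴴ =
        creation (orb y σ) * annihilation (orb x σ) := by
    intro x y σ hxy
    have hne : orb x σ ≠ orb y σ := by
      intro h
      have := congrArg (fun i : Orb Λ => (ofLex i).1) h
      exact G.ne_of_adj hxy (by simpa using this)
    have hcar := annihilation_mul_creation_add_creation_mul_annihilation_holds (orb x σ) (orb y σ)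
    rw [if_neg hne] at hcar
    have hprod : ε' (orb x σ) * ε' (orb y σ) = -1 := by
      simp only [hε', orb, ofLex_toLex]
      exact intCast_units_mul_of_eq_neg (hε x y hxy)
    rw [hsplit, particleHole_mul_creation_mul_conjTranspose ε' hn,
      particleHole_mul_annihilation_mul_conjTranspose_holds ε' hn, star_intCast_units,
      Matrix.smul_mul, Matrix.mul_smul, smul_smul, show ((ε (ofLex (orb x σ)).1 : ℤ) : ℂ) = ε' (orb x σ) from rfl,
      hprod, eq_neg_of_add_eq_zero_left hcar, neg_smul, one_smul, neg_neg]
  -- number operators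
  have hnum : ∀ (x : Λ) (σ : Fin 2), P * numberOp x σ * Pᴴ = 1 - numberOp x σ := by
    intro x σ
    have h := particleHole_mul_numberAt_mul_conjTranspose_holds ε' hn (orb x σ)
    simpa using h
  have hT : P * (∑ x : Λ, ∑ y : Λ, ∑ σ : Fin 2,
      if G.Adj x y then creation (orb x σ) * annihilation (orb y σ) else 0) * Pᴴ =
      ∑ x : Λ, ∑ y : Λ, ∑ σ : Fin 2,
        if G.Adj x y then creation (orb x σ) * annihilation (orb y σ) else 0 := by
    simp only [Finset.mul_sum, Finset.sum_mul]
    have h1 : ∀ (x y : Λ) (σ : Fin 2),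
        P * (if G.Adj x y then creation (orb x σ) * annihilation (orb y σ) else 0) * Pᴴ =
          if G.Adj y x then creation (orb y σ) * annihilation (orb x σ) else 0 := by
      intro x y σ
      by_cases hxy : G.Adj x y
      · rw [if_pos hxy, if_pos hxy.symm, hhop x y σ hxy]
      · rw [if_neg hxy, if_neg (fun h => hxy h.symm), Matrix.mul_zero, Matrix.zero_mul]
    simp only [h1]
    rw [Finset.sum_comm]
  have hV : P * (∑ x : Λ, numberOp x 0 * numberOp x 1) * Pᴴ =
      ∑ x : Λ, numberOp x 0 * numberOp x 1 - totalNumber +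
        (Fintype.card Λ : ℂ) • (1 : Matrix (Finset (Orb Λ)) (Finset (Orb Λ)) ℂ) := by
    simp only [Finset.mul_sum, Finset.sum_mul]
    have h1 : ∀ x : Λ, P * (numberOp x 0 * numberOp x 1) * Pᴴ =
        numberOp x 0 * numberOp x 1 - (numberOp x 0 + numberOp x 1) + 1 := by
      intro x
      rw [hsplit, hnum, hnum]
      noncomm_ring
    simp only [h1, Finset.sum_add_distrib, Finset.sum_sub_distrib, Finset.sum_const,
      Finset.card_univ]
    have h2 : (totalNumber : Matrix (Finset (Orb Λ)) (Finset (Orb Λ)) ℂ) =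
        ∑ x : Λ, (numberOp x 0 + numberOp x 1) := by
      unfold totalNumber
      simp [Fin.sum_univ_two]
    rw [h2, ← Nat.cast_smul_eq_nsmul ℂ, Finset.sum_add_distrib]
  have hc : (((U * Fintype.card Λ : ℝ)) : ℂ) = (U : ℂ) * (Fintype.card Λ : ℂ) := by push_cast; ring
  unfold hamiltonian
  rw [Matrix.mul_add, Matrix.add_mul, Matrix.mul_smul, Matrix.smul_mul, Matrix.mul_smul,
    Matrix.smul_mul, hT, hV, hc, ← smul_smul, smul_add, smul_sub]
  abel

end General


/-! ### Particle–hole symmetry of the sector ground-state energies -/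

section GroundEnergy

/-- The components of a unit vector have norm at most `1`. [folklore] -/
theorem norm_apply_le_one_of_dotProduct_eq_one {κ : Type*} [Fintype κ]
    {ψ : κ → ℂ} (hψ : star ψ ⬝ᵥ ψ = 1) (s : κ) : ‖ψ s‖ ≤ 1 := by
  have h2 : ∀ i, (star ψ) i * ψ i = ((‖ψ i‖ ^ 2 : ℝ) : ℂ) := fun i => by
    rw [Pi.star_apply, Complex.star_def, Complex.conj_mul', Complex.ofReal_pow]
  have hsum : ∑ i, ‖ψ i‖ ^ 2 = (1 : ℝ) := by
    rw [dotProduct] at hψ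
    simp only [h2] at hψ
    exact_mod_cast hψ
  have hle : ‖ψ s‖ ^ 2 ≤ 1 := by
    rw [← hsum]
    exact Finset.single_le_sum (f := fun i => ‖ψ i‖ ^ 2) (fun i _ => sq_nonneg _)
      (Finset.mem_univ s)
  exact (sq_le_one_iff₀ (norm_nonneg _)).1 hle

/-- A crude lower bound for expectation values in unit vectors:
`re ⟨ψ, A ψ⟩ ≥ -Σ_{s,t} ‖A_{st}‖`. [folklore] -/
theorem neg_sum_norm_le_re_expect {κ : Type*} [LinearOrder κ] [Fintype κ]
    (A : Matrix (Finset κ) (Finset κ) ℂ) {ψ : Fock κ} (hψ : star ψ ⬝ᵥ ψ = 1) :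
    -(∑ s, ∑ t, ‖A s t‖) ≤ (QuantumLattice.expect A ψ).re := by
  have h1 : ‖QuantumLattice.expect A ψ‖ ≤ ∑ s, ∑ t, ‖A s t‖ := by
    unfold QuantumLattice.expect
    simp only [dotProduct, mulVec]
    calc ‖∑ s, (star ψ) s * ∑ t, A s t * ψ t‖
        ≤ ∑ s, ‖(star ψ) s * ∑ t, A s t * ψ t‖ := norm_sum_le _ _
      _ ≤ ∑ s, ∑ t, ‖A s t‖ := Finset.sum_le_sum fun s _ => by
          rw [norm_mul, Pi.star_apply, norm_star]
          calc ‖ψ s‖ * ‖∑ t, A s t * ψ t‖ ≤ 1 * ∑ t, ‖A s t‖ := by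
                apply mul_le_mul (norm_apply_le_one_of_dotProduct_eq_one hψ s) _ (norm_nonneg _)
                  zero_le_one
                calc ‖∑ t, A s t * ψ t‖ ≤ ∑ t, ‖A s t * ψ t‖ := norm_sum_le _ _
                  _ ≤ ∑ t, ‖A s t‖ := Finset.sum_le_sum fun t _ => by
                      rw [norm_mul]
                      calc ‖A s t‖ * ‖ψ t‖ ≤ ‖A s t‖ * 1 :=
                            mul_le_mul_of_nonneg_left (norm_apply_le_one_of_dotProduct_eq_one hψ t)
                              (norm_nonneg _)
                        _ = ‖A s t‖ := mul_one _
            _ = ∑ t, ‖A s t‖ := one_mul _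
  have h2 := Complex.abs_re_le_norm (QuantumLattice.expect A ψ)
  exact neg_le_of_abs_le (h2.trans h1)

variable {Λ : Type*} [LinearOrder Λ] [Fintype Λ]

omit [LinearOrder Λ] in
/-- `|Orb Λ| = 2 |Λ|`. [folklore] -/
theorem card_orb : Fintype.card (Orb Λ) = 2 * Fintype.card Λ := by
  rw [Fintype.card_lex, Fintype.card_prod, Fintype.card_fin, mul_comm]

/-- On an `N`-particle vector the total number operator acts as `N`. [folklore] -/
theorem totalNumber_mulVec_of_isNParticle {N : ℕ} {ψ : Fock (Orb Λ)} (hψ : IsNParticle N ψ) :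
    (totalNumber : Matrix (Finset (Orb Λ)) (Finset (Orb Λ)) ℂ) *ᵥ ψ = (N : ℂ) • ψ := by
  funext s
  rw [← totalNumberOp_eq_totalNumber, totalNumberOp_eq_diagonal, mulVec_diagonal, Pi.smul_apply,
    smul_eq_mul]
  by_cases hs : s.card = N
  · rw [hs]
  · rw [hψ s hs, mul_zero, mul_zero]

variable (G : SimpleGraph Λ) [DecidableRel G.Adj]

/-- **Particle–hole symmetry of the sector ground-state energies** (Lieb–Wu's
`E(M, M') = -(N_a - N) U + E(N_a - M, N_a - M')` summed over spin). On a graph carrying a bipartite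
sign `ε` (`ε x = -ε y` on edges), for every `t`, `U` and `N ≤ 2|Λ|`:
`E(N) = E(2|Λ| - N) - (|Λ| - N) U`. Proof: `ψ ↦ Pᴴ ψ` maps unit `N`-particle vectors onto unit
`(2|Λ| - N)`-particle vectors and shifts `⟨ψ, H ψ⟩` by `U (|Λ| - N)`
(`hamiltonian_particleHole_bipartite_holds`), so the two variational sets defining the sector
energies are translates of each other. Lieb–Wu, Physica A 321 (2003) 1, §1 eq. (3); Essler et al.
(2005) eq. (6.34). [folklore] -/
theorem groundEnergyAt_particleHole (ε : Λ → ℤˣ) (hε : ∀ x y, G.Adj x y → ε x = -ε y) (t U : ℝ)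
    {N : ℕ} (hN : N ≤ 2 * Fintype.card Λ) :
    groundEnergyAt G t U N =
      groundEnergyAt G t U (2 * Fintype.card Λ - N) - ((Fintype.card Λ : ℝ) - N) * U := by
  set H := hamiltonian G t U with hH
  set ε' : Orb Λ → ℂ := fun i => ((ε (ofLex i).1 : ℤ) : ℂ) with hε'
  have hn : ∀ i, ‖ε' i‖ = 1 := fun i => norm_intCast_units _
  set P := particleHole ε' with hP
  have hconj : P * H * Pᴴ = H - (U : ℂ) • totalNumber + ((U * Fintype.card Λ : ℝ) : ℂ) • 1 :=
    hamiltonian_particleHole_bipartite_holds G t U ε hε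
  -- the variational sets
  set S : ℕ → Set ℝ := fun N =>
    {E : ℝ | ∃ ψ : Fock (Orb Λ), IsNParticle N ψ ∧ star ψ ⬝ᵥ ψ = 1 ∧ E = (QuantumLattice.expect H ψ).re}
    with hS
  have hE : ∀ N, groundEnergyAt G t U N = sInf (S N) := fun N => rfl
  -- transfer of trial states under `Pᴴ`
  have transfer : ∀ (N : ℕ) (ψ : Fock (Orb Λ)), IsNParticle N ψ → star ψ ⬝ᵥ ψ = 1 →
      IsNParticle (2 * Fintype.card Λ - N) (Pᴴ *ᵥ ψ) ∧ star (Pᴴ *ᵥ ψ) ⬝ᵥ (Pᴴ *ᵥ ψ) = 1 ∧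
        (QuantumLattice.expect H (Pᴴ *ᵥ ψ)).re = (QuantumLattice.expect H ψ).re + U * ((Fintype.card Λ : ℝ) - N) := by
    intro N ψ hψN hψ1
    refine ⟨?_, ?_, ?_⟩
    · intro s hs
      rw [particleHole_conjTranspose_mulVec_apply]
      have hc : sᶜ.card ≠ N := by
        rw [Finset.card_compl, card_orb]
        have := s.card_le_univ
        rw [card_orb] at this
        omega
      rw [hψN _ hc, mul_zero]
    · rw [star_mulVec, conjTranspose_conjTranspose, ← dotProduct_mulVec, mulVec_mulVec,
        particleHole_mul_conjTranspose ε' hn, one_mulVec, hψ1]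
    · have h1 : QuantumLattice.expect H (Pᴴ *ᵥ ψ) =
          QuantumLattice.expect H ψ - (U : ℂ) * N + ((U * Fintype.card Λ : ℝ) : ℂ) := by
        unfold QuantumLattice.expect
        rw [star_mulVec, conjTranspose_conjTranspose, ← dotProduct_mulVec, mulVec_mulVec,
          mulVec_mulVec, hconj, add_mulVec, sub_mulVec, smul_mulVec, smul_mulVec, one_mulVec,
          totalNumber_mulVec_of_isNParticle hψN, dotProduct_add, dotProduct_sub, dotProduct_smul,
          dotProduct_smul, dotProduct_smul, hψ1]
        simp only [smul_eq_mul, mul_one]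
      rw [h1]
      simp only [Complex.sub_re, Complex.add_re, Complex.ofReal_re, Complex.mul_re,
        Complex.ofReal_im, Complex.natCast_re, Complex.natCast_im, mul_zero, sub_zero]
      ring
  -- the sets are translates of each other
  set c : ℝ := U * ((Fintype.card Λ : ℝ) - N) with hc
  have hset : S (2 * Fintype.card Λ - N) = (OrderIso.addRight c) '' S N := by
    ext E
    simp only [Set.mem_image, OrderIso.addRight_apply]
    constructor
    · rintro ⟨ψ, hψN, hψ1, rfl⟩
      obtain ⟨h1, h2, h3⟩ := transfer _ ψ hψN hψ1
      have hNN : 2 * Fintype.card Λ - (2 * Fintype.card Λ - N) = N := by omega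
      rw [hNN] at h1
      refine ⟨(QuantumLattice.expect H (Pᴴ *ᵥ ψ)).re, ⟨Pᴴ *ᵥ ψ, h1, h2, rfl⟩, ?_⟩
      rw [h3, hc, Nat.cast_sub hN]
      push_cast
      ring
    · rintro ⟨E₀, ⟨ψ, hψN, hψ1, rfl⟩, rfl⟩
      obtain ⟨h1, h2, h3⟩ := transfer _ ψ hψN hψ1
      exact ⟨Pᴴ *ᵥ ψ, h1, h2, by rw [h3]⟩
  -- nonempty and bounded below
  have hne : (S N).Nonempty := by
    have hcard : N ≤ (Finset.univ : Finset (Orb Λ)).card := by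
      rw [Finset.card_univ, card_orb]; exact hN
    obtain ⟨s, -, hs⟩ := Finset.exists_subset_card_eq hcard
    refine ⟨_, Pi.single s 1, ?_, ?_, rfl⟩
    · intro s' hs'
      rw [Pi.single_apply, if_neg]
      rintro rfl
      exact hs' hs
    · rw [dotProduct_single, Pi.star_apply, Pi.single_eq_same, star_one, one_mul]
  have hbdd : BddBelow (S N) := by
    refine ⟨-(∑ s, ∑ t, ‖H s t‖), ?_⟩
    rintro E ⟨ψ, -, hψ1, rfl⟩
    exact neg_sum_norm_le_re_expect H hψ1
  have key : sInf (S (2 * Fintype.card Λ - N)) = sInf (S N) + c := by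
    rw [hset, ← OrderIso.map_csInf' (OrderIso.addRight c) hne hbdd, OrderIso.addRight_apply]
  rw [hE, hE, key, hc]
  ring

end GroundEnergy

section Torus

/-- **Particle–hole symmetry on the even torus.** On `(ℤ/Lℤ)^d` with `L` even and `N ≤ 2 L^d`:
`E(N) = E(2L^d - N) - (L^d - N) U` for the Hubbard Hamiltonian with any `t`, `U`.
Lieb–Wu, Physica A 321 (2003) 1, §1 eq. (3). [folklore] -/
theorem groundEnergyAt_fermionTorus_particleHole {d L : ℕ} (hL : Even L) (t U : ℝ) {N : ℕ}
    (hN : N ≤ 2 * L ^ d) :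
    groundEnergyAt (fermionTorusGraph d L) t U N =
      groundEnergyAt (fermionTorusGraph d L) t U (2 * L ^ d - N) - ((L ^ d : ℝ) - N) * U := by
  have hcard : Fintype.card (FermionTorus d L) = L ^ d := by simp [FermionTorus, Fintype.card_lex]
  have h := groundEnergyAt_particleHole (fermionTorusGraph d L) torusStagger
    (fun x y hxy => torusStagger_eq_neg_of_adj_holds hL hxy) t U
    (N := N) (by rw [hcard]; exact hN)
  rw [hcard] at h
  rw [h]
  push_cast
  ring

/-- **The Hubbard ring** (`d = 1`, the setting of `Literature.MathematicalPhysics.QuantumLattice.lieb_wu`): on the ring of even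
length `2n`, `E(N) = E(4n - N) - (2n - N) U` for `N ≤ 4n`; in particular
`E(2n + 1) = E(2n - 1) + U`. This is the statement of the named fact
`Literature.MathematicalPhysics.QuantumLattice.hubbardChain_groundEnergyAt_particleHole` (F5a of the Lieb–Wu decomposition).
Lieb–Wu, Physica A 321 (2003) 1, §1 eq. (3); Essler et al. (2005) eq. (6.34). [folklore] -/
theorem groundEnergyAt_hubbardRing_particleHole (n : ℕ) (t U : ℝ) (N : ℕ) (hN : N ≤ 4 * n) :
    groundEnergyAt (fermionTorusGraph 1 (2 * n)) t U N =
      groundEnergyAt (fermionTorusGraph 1 (2 * n)) t U (4 * n - N) - ((2 * n : ℝ) - N) * U := by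
  have h := groundEnergyAt_fermionTorus_particleHole (d := 1) (L := 2 * n) ⟨n, two_mul n⟩ t U
    (N := N) (by rw [pow_one]; omega)
  simp only [pow_one] at h
  rw [h, show 2 * (2 * n) - N = 4 * n - N by omega]
  push_cast
  ring

end Torus

end Literature.MathematicalPhysics.QuantumLattice
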